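import Summits.AtomisticToContinuum.Crystallization.Theorems.FrustratedLawDichotomyStrainedPatchTaylorLeaves

/-!
# (R) `WrecC1` PROVED: the record potential `W₄₅` is `C¹` on `(0, ∞)` with `W₄₅′` differentiable off the junction radii (lens-5 g53, crux 27623 T-side)

Closes leaf (R) of node (T2-bent₁) (`…TaylorLeaves.WrecC1`): `deriv W₄₅` is continuous on `(0, ∞)` and differentiable at every `r > 0` off
`{8/5, 3, 9/2}`.  PROOF: the explicit global derivative of `hasDerivAt_effPot45` is rewritten as a function built from continuous pieces — the two
clip indicators become `(4/9)·max(0, (2r − 6)(9 − 2r))` (`cutD_eq`) and `dOmega (min (5r/4) 2)` (`bumpD_eq`, using `ω₂′(2) = 0`) — hence continuous at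
every `r ≠ 0` (`continuousAt_dW`), and `deriv W₄₅ = dW` on `(0, ∞)`; off the junctions `deriv W₄₅` agrees near `r` with one of the four closed-regime
formulas `deriv_effPot45_{bump,lj,window,far}`, each differentiable at `r ≠ 0` (`Filter.EventuallyEq.differentiableAt_iff`).
Seams: `wrecC1_holds : WrecC1`, `pairChord_of_kband : KbandCert → PairChord`, and the node's leaf-level seam with (R) discharged,
`taylorTwoBent1_of_NT : KbandCert → BeyondBallTail → TaylorTwoBent1` — the T2-bent₁ leaves are now (N) `KbandCert` [band numerics] and (P3b) `BeyondBallTail`.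
-/

open scoped BigOperators Classical
open Summit.AtomisticToContinuum.Crystallization.Theorems.FrustratedLawDichotomyRangeCut (Sep)
open Summit.AtomisticToContinuum.Crystallization.Theorems.FrustratedLawDichotomyMotifLemmas
open Summit.AtomisticToContinuum.Crystallization.Theorems.FrustratedLawDichotomyAveragingCut
open Summit.AtomisticToContinuum.Crystallization.Theorems.FrustratedLawDichotomyAveragingRuleCap
open Summit.AtomisticToContinuum.Crystallization.Theorems.FrustratedLawDichotomyAveragingRuleTightFree
open Summit.AtomisticToContinuum.Crystallization.Theorems.FrustratedLawDichotomyExemptAbsorptionRecord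
open Summit.AtomisticToContinuum.Crystallization.Theorems.FrustratedLawDichotomySchurCut
open Literature.MathematicalPhysics.StatisticalMechanics (lennardJones lennardJones_nonpos)
open Summit.AtomisticToContinuum.Crystallization.Theorems.FrustratedLawDichotomyRuleToolkitGood
open Summit.AtomisticToContinuum.Crystallization.Theorems.FrustratedLawDichotomyStrainedPatchHomSplit
open Summit.AtomisticToContinuum.Crystallization.Theorems.FrustratedLawDichotomyStrainedPatchHomTermCalculus
open Summit.AtomisticToContinuum.Crystallization.Theorems.FrustratedLawDichotomyStrainedPatchChartFamilies
open Summit.AtomisticToContinuum.Crystallization.Theorems.FrustratedLawDichotomyStrainedPatchChartFamiliesBent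
open Summit.AtomisticToContinuum.Crystallization.Theorems.FrustratedLawDichotomyStrainedPatchChartFamiliesPinned
open Summit.AtomisticToContinuum.Crystallization.Theorems.FrustratedLawDichotomyStrainedPatchEnvelopeLaw
open Summit.AtomisticToContinuum.Crystallization.Theorems.FrustratedLawDichotomyStrainedPatchEnvelopeTaylor

open Summit.AtomisticToContinuum.Crystallization.Theorems.FrustratedLawDichotomyStrainedPatchTaylorSplit
open Summit.AtomisticToContinuum.Crystallization.Theorems.FrustratedLawDichotomyStrainedPatchTaylorPair
open Summit.AtomisticToContinuum.Crystallization.Theorems.FrustratedLawDichotomyStrainedPatchTaylorChord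

open Summit.AtomisticToContinuum.Crystallization.Theorems.FrustratedLawDichotomyStrainedPatchTaylorLeaves

namespace Summit.AtomisticToContinuum.Crystallization.Theorems.FrustratedLawDichotomyStrainedPatchTaylorRegular

/-! ## §1. The explicit derivative as a continuous function -/

/-- The derivative polynomial of the bump profile `ω₂`. -/
noncomputable def dOmega (u : ℝ) : ℝ :=
  -(11 / 3) * u + 33 / 4 * u ^ 3 - 385 / 64 * u ^ 4 + 231 / 256 * u ^ 6 - 99 / 1024 * u ^ 8 + 55 / 12288 * u ^ 10

/-- The clipped cutoff derivative is `(4/9)·max(0, (2r − 6)(9 − 2r))`. -/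
theorem cutD_eq (r : ℝ) :
    (if 3 < r ∧ r < 9 / 2 then 4 / 9 * (2 * r - 6) * (9 - 2 * r) else (0:ℝ)) = 4 / 9 * max 0 ((2 * r - 6) * (9 - 2 * r)) := by
  by_cases hr : 3 < r ∧ r < 9 / 2
  · rw [if_pos hr, max_eq_right (by nlinarith [hr.1, hr.2]), mul_assoc]
  · rw [if_neg hr]
    have : (2 * r - 6) * (9 - 2 * r) ≤ 0 := by
      rcases not_and_or.1 hr with h | h
      · have h1 : 2 * r - 6 ≤ 0 := by linarith [not_lt.1 h]
        have h2 : 0 ≤ 9 - 2 * r := by linarith [not_lt.1 h]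
        nlinarith [mul_nonneg (neg_nonneg.2 h1) h2]
      · have h1 : 0 ≤ 2 * r - 6 := by linarith [not_lt.1 h]
        have h2 : 9 - 2 * r ≤ 0 := by linarith [not_lt.1 h]
        nlinarith [mul_nonneg h1 (neg_nonneg.2 h2)]
    rw [max_eq_left this, mul_zero]

/-- The clipped bump derivative is `dOmega (min (5r/4) 2)` (`dOmega 2 = 0`). -/
theorem bumpD_eq (r : ℝ) :
    (if 5 * r / 4 < 2 then -(11 / 3) * (5 * r / 4) + 33 / 4 * (5 * r / 4) ^ 3 - 385 / 64 * (5 * r / 4) ^ 4 +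
      231 / 256 * (5 * r / 4) ^ 6 - 99 / 1024 * (5 * r / 4) ^ 8 + 55 / 12288 * (5 * r / 4) ^ 10 else (0:ℝ)) = dOmega (min (5 * r / 4) 2) := by
  by_cases h : 5 * r / 4 < 2
  · rw [if_pos h, min_eq_left h.le, dOmega]
  · rw [if_neg h, min_eq_right (not_lt.1 h), dOmega]; norm_num

/-- The explicit derivative of `W₄₅` as a function built from continuous pieces. -/
noncomputable def dW (r : ℝ) : ℝ :=
  (-(r⁻¹) ^ 13 + (r⁻¹) ^ 7) * (1 - w₄₅ r) - lennardJones r * (4 / 9 * max 0 ((2 * r - 6) * (9 - 2 * r))) -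
    3 / 160 * dOmega (min (5 * r / 4) 2)

/-- `W₄₅′ = dW` at every `r ≠ 0`. [folklore] -/
theorem hasDerivAt_Wrec {r : ℝ} (hr : r ≠ 0) : HasDerivAt Wrec (dW r) r := by
  refine (hasDerivAt_effPot45 hr).congr_deriv ?_
  rw [dW, cutD_eq, bumpD_eq]

/-- `w₄₅` is continuous (it is `C¹`). [formal bookkeeping] -/
theorem continuous_w₄₅ : Continuous w₄₅ := continuous_iff_continuousAt.2 fun r => (hasDerivAt_w₄₅ r).continuousAt

/-- `V` as an explicit rational function. [formal bookkeeping] -/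
theorem lennardJones_eq : lennardJones = fun y : ℝ => (1 / 12 : ℝ) * (y⁻¹) ^ 12 - (1 / 6 : ℝ) * (y⁻¹) ^ 6 := by
  funext y; simp [lennardJones]

-- `differentiableAt_lennardJones` is already landed (`…ExcessDecayLiouvilleForceBalance.differentiableAt_lennardJones`, gate dedup);
-- its one-line proof is inlined at the two call sites below to keep this module's imports light.

/-- `dOmega` is continuous (a polynomial). [formal bookkeeping] -/
theorem continuous_dOmega : Continuous dOmega := by
  have : dOmega = fun u : ℝ => -(11 / 3) * u + 33 / 4 * u ^ 3 - 385 / 64 * u ^ 4 + 231 / 256 * u ^ 6 - 99 / 1024 * u ^ 8 +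
      55 / 12288 * u ^ 10 := by funext u; rfl
  rw [this]; fun_prop

/-- ★ `dW` is continuous at every `r ≠ 0`. [folklore] -/
theorem continuousAt_dW {r : ℝ} (hr : r ≠ 0) : ContinuousAt dW r := by
  have hw : Continuous w₄₅ := continuous_w₄₅
  have hLJd : DifferentiableAt ℝ lennardJones r := by rw [lennardJones_eq]; fun_prop (disch := exact hr)
  have hLJ : ContinuousAt lennardJones r := hLJd.continuousAt
  have hΩ : Continuous dOmega := continuous_dOmega
  have hmax : Continuous fun r : ℝ => max 0 ((2 * r - 6) * (9 - 2 * r)) := continuous_const.max (by fun_prop)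
  have hmin : Continuous fun r : ℝ => dOmega (min (5 * r / 4) 2) := hΩ.comp ((by fun_prop : Continuous fun r : ℝ => 5 * r / 4).min continuous_const)
  have hA : ContinuousAt (fun r : ℝ => -(r⁻¹) ^ 13 + (r⁻¹) ^ 7) r := by fun_prop (disch := exact hr)
  have hfun : dW = fun r => (-(r⁻¹) ^ 13 + (r⁻¹) ^ 7) * (1 - w₄₅ r) - lennardJones r * (4 / 9 * max 0 ((2 * r - 6) * (9 - 2 * r))) -
      3 / 160 * dOmega (min (5 * r / 4) 2) := by funext r; rfl
  rw [hfun]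
  exact ((hA.mul (continuous_const.sub hw).continuousAt).sub (hLJ.mul (continuous_const.mul hmax).continuousAt)).sub
    (continuous_const.mul hmin).continuousAt

/-! ## §2. (R) proved -/

/-- ★ `W₄₅′` is continuous on `(0, ∞)`. [folklore] -/
theorem continuousOn_deriv_Wrec : ContinuousOn (deriv Wrec) (Set.Ioi 0) := by
  refine ContinuousOn.congr (f := dW) (fun r hr => (continuousAt_dW (ne_of_gt hr)).continuousWithinAt) (fun r hr => ?_)
  exact (hasDerivAt_Wrec (ne_of_gt hr)).deriv

/-- ★ `W₄₅′` is differentiable at every `r > 0` off the junction radii `{8/5, 3, 9/2}`. [folklore] -/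
theorem differentiableAt_deriv_Wrec {r : ℝ} (h0 : 0 < r) (hJ : r ∉ junctions) : DifferentiableAt ℝ (deriv Wrec) r := by
  have h1 : r ≠ 8 / 5 ∧ r ≠ 3 ∧ r ≠ 9 / 2 := by simpa [junctions] using hJ
  have hr0 : r ≠ 0 := h0.ne'
  have hLJ : DifferentiableAt ℝ lennardJones r := by rw [lennardJones_eq]; fun_prop (disch := exact hr0)
  rcases lt_or_gt_of_ne h1.1 with ha | ha
  · have heq : deriv Wrec =ᶠ[nhds r] fun s => (-(s⁻¹) ^ 13 + (s⁻¹) ^ 7) - 3 / 160 * (-(11 / 3) * (5 * s / 4) + 33 / 4 * (5 * s / 4) ^ 3 -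
        385 / 64 * (5 * s / 4) ^ 4 + 231 / 256 * (5 * s / 4) ^ 6 - 99 / 1024 * (5 * s / 4) ^ 8 + 55 / 12288 * (5 * s / 4) ^ 10) := by
      filter_upwards [Ioo_mem_nhds h0 ha] with s hs using deriv_effPot45_bump hs.1 hs.2.le
    refine heq.differentiableAt_iff.2 ?_
    fun_prop (disch := exact hr0)
  rcases lt_or_gt_of_ne h1.2.1 with hb | hb
  · have heq : deriv Wrec =ᶠ[nhds r] fun s => -(s⁻¹) ^ 13 + (s⁻¹) ^ 7 := by
      filter_upwards [Ioo_mem_nhds ha hb] with s hs using deriv_effPot45_lj hs.1.le hs.2.le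
    refine heq.differentiableAt_iff.2 ?_
    fun_prop (disch := exact hr0)
  rcases lt_or_gt_of_ne h1.2.2 with hc | hc
  · have heq : deriv Wrec =ᶠ[nhds r] fun s => (-(s⁻¹) ^ 13 + (s⁻¹) ^ 7) * ((16 * s ^ 3 - 180 * s ^ 2 + 648 * s - 729) / 27) +
        lennardJones s * ((16 * s ^ 2 - 120 * s + 216) / 9) := by
      filter_upwards [Ioo_mem_nhds hb hc] with s hs using deriv_effPot45_window hs.1.le hs.2.le
    refine heq.differentiableAt_iff.2 ?_
    fun_prop (disch := exact hr0)
  · have heq : deriv Wrec =ᶠ[nhds r] fun _ => (0:ℝ) := by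
      filter_upwards [Ioi_mem_nhds hc] with s hs using deriv_effPot45_far hs.le
    exact heq.differentiableAt_iff.2 (differentiableAt_const _)

/-- ★★ **(R) PROVED.** [folklore] -/
theorem wrecC1_holds : WrecC1 := ⟨continuousOn_deriv_Wrec, fun _ h0 hJ => differentiableAt_deriv_Wrec h0 hJ⟩

/-! ## §3. Seams with (R) discharged -/

/-- (P2a-core) from the band numerics alone: `KbandCert → PairChord`. [folklore] -/
theorem pairChord_of_kband (hK : KbandCert) : PairChord := pairChord_of_leaves wrecC1_holds hK

/-- ★★ THE (T2-bent₁) SEAM with (C) and (R) discharged: (N) ∧ (P3b) ⟹ `TaylorTwoBent1`. [folklore] -/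
theorem taylorTwoBent1_of_NT (hK : KbandCert) (h3b : BeyondBallTail) : TaylorTwoBent1 := taylorTwoBent1_of_leaves wrecC1_holds hK h3b

end Summit.AtomisticToContinuum.Crystallization.Theorems.FrustratedLawDichotomyStrainedPatchTaylorRegular
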